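import Literature.NumberTheory.LFunctions.Zhang2022.KnifeEdgeEllVernierForm
import Literature.NumberTheory.LFunctions.Zhang2022.ObjectiveTwinDetEdgeFamilyLimit

/-!
# §D edge ell — vernier cells at the maximal straddle `θ = ½`: the negative side of `VernierGridDichotomy J m`
# for EVERY `J ≥ 2` and EVERY margin `|m| < ½`, from ls-obj-eng-3's edge-family law

Y. Zhang, *Discrete mean estimates and the Landau–Siegel zero*, arXiv:2211.02515v1 [Zhang2022LandauSiegel] — an
unrefereed manuscript under adjudication. **WHAT THIS IS NOT: not a claim about Theorems 1–2 of arXiv:2211.02515, about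
Landau–Siegel zeros, about Parity, or about a repaired `Margin232`. The card `ell-vernier-far-pair` is CLOSED
(`closed:falsified:j263358+j265145`); the edge `b₀ = 1` is its INADMISSIBLE side — nothing here concerns an admissible
design. The programme SEARCHES and TYPES; no claim about Landau–Siegel zeros, Theorems 1–2 of arXiv:2211.02515 or a
repaired Margin232 until a kernel theorem says so.** (LANDAU–SIEGEL programme F-S3, cell `landau-siegel`, §D edge ell;
typer ls-knife-typer-2 g4; referee ls-ref-1 g2, cell INBOX 2026-08-27T02:07:54Z: «a clean general-J statement for
typer-2's `not_vernierGridPSD_edge` family».)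

The grid-unit vernier triple at offset `θ = ½` is the symmetric edge triple: `vernierShiftsOff 1 J m ½ = (1, J−w, J+w)`
with `w = ½ − m` (`vernierShiftsOff_half`). ls-obj-eng-3's `Det.not_formDetPSD_edgeFamily`
(`ObjectiveTwinDetEdgeFamilyLimit`, part 18e/f: `FormDet(shiftRecipe(1, J−w, J+w))(k₁ + (−1)^J k_J) =
−4(1 − cos πw)(1 + [J odd](2J−1)w²/(J²(J−1−w)(J−1+w))) − 2πw·sin(πw)(1 + w²/(J(J−1−w)(J−1+w))) < 0` for every
`J ≥ 2`, `0 < w < 1`) therefore gives, for ALL cells at once: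

* `KnifeEdgeEll.Vernier.not_vernierGridPSD_half : 2 ≤ J → −½ < m → m < ½ → ¬ VernierGridPSD 1 J m ½` — the negative
  side of the per-cell statement `VernierGridDichotomy J m` (`KnifeEdgeEllVernierForm` Part C) at the maximal straddle,
  previously a kernel fact at the single cell `(J, m, θ) = (3, 0, ½)` (`not_vernierGridPSD_edge`);
* `KnifeEdgeEll.Vernier.vernierGridForm_half_neg` — the explicit negative one-sided value on the witness.

Theorems only; no definitions. References: Zhang, arXiv:2211.02515v1, §2 (2.13), Lemma 2.3 p.6; Prop 7.1 p.44
[cite: Zhang2022LandauSiegel, §2 (2.13); Prop 7.1 p.44].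
-/

noncomputable section

open Complex Real

namespace Literature.NumberTheory.LFunctions.Zhang2022.KnifeEdgeEll.Vernier

open Literature.NumberTheory.LFunctions.Zhang2022 Repair Objective

/-- At offset `θ = ½` the grid-unit vernier triple is the symmetric edge triple `(1, J−w, J+w)`, `w = ½ − m`.
[cite: Zhang2022LandauSiegel, §2 (2.13)] -/
theorem vernierShiftsOff_half (J : ℕ) (m : ℝ) :
    vernierShiftsOff 1 J m (1 / 2) = ![1, (J : ℝ) - (1 / 2 - m), (J : ℝ) + (1 / 2 - m)] := by
  funext j; fin_cases j <;> (simp [vernierShiftsOff]; try ring)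

/-- The booked recipe at `θ = ½` is the edge-family recipe `Det.shiftRecipe (1, J−w, J+w)`, `w = ½ − m`.
[cite: Zhang2022LandauSiegel, Prop 7.1 p.44, (7.19)–(7.21)] -/
theorem vernierGridRecipe_half (J : ℕ) (m : ℝ) :
    vernierGridRecipe 1 J m (1 / 2) = Det.shiftRecipe ![1, (J : ℝ) - (1 / 2 - m), (J : ℝ) + (1 / 2 - m)] := by
  rw [vernierGridRecipe, vernierShiftsOff_half]

/-- **The booked far-pair vernier recipe at the maximal straddle is NOT PSD, for EVERY `J ≥ 2` and EVERY margin
`m ∈ (−½, ½)`**: `¬ VernierGridPSD 1 J m ½` — the negative side of `VernierGridDichotomy J m` at `θ = ½` for all cells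
at once (ls-obj-eng-3's `Det.not_formDetPSD_edgeFamily` read in vernier coordinates). Inadmissible side only.
[cite: Zhang2022LandauSiegel, §2 (2.13), Lemma 2.3 p.6; Prop 7.1 p.44] -/
theorem not_vernierGridPSD_half {J : ℕ} (hJ : 2 ≤ J) {m : ℝ} (hm : -(1 / 2) < m) (hm' : m < 1 / 2) :
    ¬ VernierGridPSD 1 J m (1 / 2) := by
  unfold VernierGridPSD
  rw [vernierGridRecipe_half]
  exact Det.not_formDetPSD_edgeFamily hJ (by linarith) (by linarith)

/-- **The explicit negative one-sided value**: on the two-term witness `k₁ + (−1)^J k_J` the booked form at `θ = ½` is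
`< 0` (`J ≥ 2`, `|m| < ½`; value = the edge-family law at `w = ½ − m`, `Det.formDet_edgeFamily`).
[cite: Zhang2022LandauSiegel, Prop 7.1 p.44; §2 (2.13)] -/
theorem vernierGridForm_half_neg {J : ℕ} (hJ : 2 ≤ J) {m : ℝ} (hm : -(1 / 2) < m) (hm' : m < 1 / 2) :
    vernierGridForm 1 J m (1 / 2)
        (fun y => (1:ℂ) * afeDir 1 y + ((-1 : ℂ) ^ J) * afeDir J y)
        (fun y => (1:ℂ) * afeDir' 1 y + ((-1 : ℂ) ^ J) * afeDir' J y) < 0 := by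
  unfold vernierGridForm
  rw [vernierGridRecipe_half]
  exact Det.formDet_edgeFamily_neg hJ (by linarith) (by linarith)

/-- Hence at `θ = ½` the dichotomy `VernierGridDichotomy J m` (`0 < m < ½`, `J ≥ 2`) holds at that offset in the
expected direction: its left side is FALSE and so is its right side (`½ ∉ {θ ≤ m} ∪ {1 − m ≤ θ}`), i.e. the cell
`(J, m, ½)` is a straddling, non-PSD cell — consistent with «PSD iff sign-admissible» there.
[cite: Zhang2022LandauSiegel, §2 (2.13), Lemma 2.3 p.6] -/
theorem vernierGridPSD_half_iff {J : ℕ} (hJ : 2 ≤ J) {m : ℝ} (hm : 0 < m) (hm' : m < 1 / 2) :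
    (VernierGridPSD 1 J m (1 / 2) ↔ ((1 : ℝ) / 2 ≤ m ∨ 1 - m ≤ 1 / 2)) := by
  constructor
  · intro h; exact absurd h (not_vernierGridPSD_half hJ (by linarith) hm')
  · rintro (h | h) <;> linarith

end Literature.NumberTheory.LFunctions.Zhang2022.KnifeEdgeEll.Vernier
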